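import Mathlib
import HarnessLib
import HarnessLib.Audit
import Summits.AtomisticToContinuum.Statement
import Literature.MathematicalPhysics.StatisticalMechanics.LennardJonesClusters
import Literature.MathematicalPhysics.StatisticalMechanics.CrystallizationLocalLimit
import Literature.MathematicalPhysics.StatisticalMechanics.BarlowStackingEnergy
import Summits.AtomisticToContinuum.Crystallization.Theorems.ChargedEnergyGap.Negative.Unconditional
import HarnessLib.Audit.Status.Attr

/-!
Route: PerronTransitivity

DORMANT since 2026-08-25T11:43:59Z (reconciler: no traction for 7.7 d (last activity item-evidence-added at 2026-08-17T19:13:51Z); parked, not closed — `ledger route dormant route-AtomisticToContinuum-PerronTransitivity --off` to reacti) — unstaffed, not closed; items shared with open routes are served there. `ledger route dormant <id> --off` reactivates.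

# Route PerronTransitivity — no fractional gain — free site weights make LJ ground-state limits
energy-transitive; uniform binding is rigid

Write E* := ⨅ over periodic configurations Q of ℝ³ of the Lennard-Jones energy per particle e(Q)
(Blanc–Lewin units V = r⁻¹²/12 − r⁻⁶/6;
E(N)/N → E* is PROVED in tree, crysEnergyLimit). It suffices to show X = K* ∧ M* (card
no-fractional-gain-perron-transitivity, critic grade
new-mechanism). K* = NoFractionalGain (NO FRACTIONAL GAIN, the copositive form): for every finite
configuration x of distinct points and
every choice of NON-NEGATIVE REAL SITE WEIGHTS c, Σ_(i≠j) c_i c_j V_LJ(|x_i − x_j|) ≥ 2E*·Σ_i c_i² —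
fractional, ℓ²-normalised occupation of
sites never binds better than integer occupation of a crystal (c ≡ 1 is the Kepler-type floor E(x) ≥
N·E*; the content is the free weights;
on 2^(−1/6)-separated x it says the Perron root of the binding kernel [−V_ij] is ≤ 2|E*|). M* =
UniformBindingRigidity (UNIFORM BINDING IS
RIGID): a non-empty uniformly discrete X ⊆ ℝ³ EVERY site of which has site energy Σ_(q∈X∖p)
V_LJ(|p−q|) ≤ 2E* (each site bound at least as
well as the crystal average) is the point set of a periodic configuration attaining E* (expected:
relaxed hcp, a* ≈ 0.9712). The bridge
between them is free (support FractionalGainGivesTransitivity, provable now): testing K* on a ground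
state with c = 1 + t·1_S shows that
θ-super-bound sites S have density → 0, the pinned total Σ_i U_i = 2|E*|N − o(N) then kills
sub-bound sites too, and a local limit around
particles good at all scales is EXACTLY ENERGY-TRANSITIVE (TransitiveLocalLimit: every site energy =
2E*); M* turns that limit into a
periodic minimiser sitting in the hull of the ground states, which is both conjuncts (local-limit
criterion + crysEnergyLimit, both proved in tree).
Lean: `NoFractionalGain ∧ UniformBindingRigidity`

## Assembly
Deciding theorem `closes : NoFractionalGain → FractionalGainGivesTransitivity →
UniformBindingRigidity → _root_.Crystallization`, PROVED
sorry-free in the planner's Sketch.lean (lean check rc 0; axioms propext, Classical.choice,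
Quot.sound), using two PROVED tree theorems
inside the proof: for every ground-state sequence x, the support applied to K* gives the transitive
local limit (X, σ, τ); M* gives a
periodic P with P.points = X and IsLeast; conjunct (ii): the translated subsequence x^(σ j) + τ_j is
uniformly separated
(LennardJonesMinimalDistance_holds, translations are isometries) and eventually matched with
P.points on every ball, so the proved
criterion PeriodicConfiguration.tendsto_sum_of_eventually_near' (CrystallizationLocalLimit.lean)
gives Blanc–Lewin local convergence with
multiplicity m ≡ 1, i.e. IsCrystallizing lennardJones 3 (this is the content of the shared
HullCriterion stmt-3243, used here in its
eventual form, no diagonal extraction needed); conjunct (i): a ground-state sequence exists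
(LennardJonesGroundStatesExist_holds), its
limit's P is least, IsLeast.csInf_eq rewrites ⨅ = e(P) in the proved
Theorems.ChargedEnergyGapNegative.crysEnergyLimit (= stmt-0626), giving
HasPeriodicGroundStateEnergy lennardJones 3.
TransitiveLocalLimit is a derived waypoint (hKT hK) and BarlowTransitivityLemma the first rung of
M*; neither is a hypothesis of
`closes` (no separate Target item is filed: X = NoFractionalGain ∧ UniformBindingRigidity is the
pair of cruxes ranked 2 and 3).

Rationale: WHY THIS LINE. Mechanism (imported from analytic number theory / spectral extremal combinatorics):
replace the MEAN extremal problem e* = inf E/N by its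
λ_max-version with free non-negative site weights — the template is the Montgomery–Vaughan
generalized Hilbert inequality
(MontgomeryVaughan1974, Thm 1: a sharp uniform operator-norm bound for a kernel over all
well-separated point sets, extremal at the
progression) and Motzkin–Straus / spectral Turán (doi:10.4153/CJM-1965-053-6: λ_max-versions of
extremal statements are stronger AND force
regularity of the extremisers); here the kernel is the configuration's own Lennard-Jones matrix and
"regularity" is ENERGY-TRANSITIVITY of
ground-state local limits, obtained at finite N by one variation of the weights (no transfer rule,
no cell, no shell classification, no
Fourier positivity — Bochner certificates are weight-blind and imply K*, but K* is strictly weaker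
than two-point LP tightness, which is
probably gapped in d = 3, Li2022). The endgame is then a rigidity theorem under the STRONGEST
hypothesis one can ask — every site of one
configuration bound at least 2|E*|, exactly and uniformly — where tetrahedral frustration is met in
minimax form ("no configuration is
uniformly super-bound") and stacking selection is a two-line word lemma (transitivity +
super-decreasing registry differences ⇒ ABAB;
support BarlowTransitivityLemma), instead of the averaged / o(N) / fixed-tolerance hypotheses every
certificate, kissing and hull route on
this sub-problem must handle. No open route weights sites or uses the spectral radius / copositive
value of the interaction matrix
(PRVarianceCertificate's free weights are Cauchy–Schwarz multipliers on the dual side;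
FrustrationRangeCertificates / PalmUnimodularRigidity
relax laws, not occupancy); the negatives index (EffectiveLocalHales stmt-4146, OneGrainGluing
stmt-3506) concerns η-soft local statements,
none of which occurs here (K* is exact and global, M* is exact and uniform).

RANKED CRUXES. #2 NoFractionalGain (crux) — K* (card K1, copositive form, no separation hypothesis):
for every N, every injective x : Fin N → ℝ³ and every c : Fin N → ℝ with c ≥ 0, 2·E*·Σ_i c_i² ≤ Σ_i
Σ_(j≠i) c_i c_j V_LJ(dist x_i x_j), E* = ⨅_Q e_LJ(Q). At c ≡ 1 this is the finite Kepler-type floor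
E(x) ≥ N·E*; sharp (c ≡ 1 on large hcp blocks). [difficulty: XL] (why it might fail: one periodic
structure whose k=0 Bloch symbol of [−V_ij] has λ_max > 2|E*|: margins 1.0·10⁻⁴ (fcc), 5·10⁻⁵
(dhcp), 3.5·10⁻⁵ (9R) in Barlow, 1.4 % at the best Frank–Kasper site; a Z14/Z16-rich phase
concentrating Perron weight on super-bound sites kills it; potential-specific.)
[MontgomeryVaughan1974, doi:10.4153/CJM-1965-053-6, BlancLewin2015, Li2022,
Literature.Barriers.AtomisticToContinuum.IcosahedralClusters]
#3 UniformBindingRigidity (crux) — M* (card K2, minimax rigidity, lattice-agnostic conclusion): a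
non-empty uniformly discrete X ⊆ ℝ³ with Σ'_(q ∈ X, q ≠ p) V_LJ(dist p q) ≤ 2E* at EVERY p ∈ X
equals P.points for a periodic configuration P with IsLeast (range e_LJ) (e_LJ P). Expected witness:
relaxed hcp (vertex-transitive, hcpStacking_homogeneous); inside the Barlow class it is the word
lemma BarlowTransitivityLemma; voids, surfaces, faults and strain gradients all under-bind some
site, so the uniform hypothesis excludes them for free. [difficulty: XL] (why it might fail: uniform
super-binding may be realisable by frustrated order: single sites reach 0.986 (σ) / 0.969 (A15) of
the hcp level, a compressed icosahedral centre exceeds it; M* bets NO configuration has ALL sites ≥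
2|E*| but periodic minimisers — zero slack, no 3-D extremal-site precedent.) [Hales2012,
FlatleyTheil2015, LoachAckland2017, Literature.Barriers.AtomisticToContinuum.TetrahedralFrustration,
Literature.Barriers.AtomisticToContinuum.IcosahedralClusters,
Literature.Barriers.AtomisticToContinuum.KissingTwelveDegeneracy]
#4 TransitiveLocalLimit (crux) — EXACTLY ENERGY-TRANSITIVE LOCAL LIMIT (card P1+P2 made one
statement): every sequence of Lennard-Jones ground states x^N in ℝ³ has, along a subsequence σ and
after translations τ_j, a non-empty uniformly discrete local limit X (two-way ε-matching on every
ball ‖·‖ ≤ R, eventually in j — the clause of IsLocalLimitOfGroundStates) every site of which has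
site energy EXACTLY 2E*. Derived from K* by the support FractionalGainGivesTransitivity; attackable
directly (it is what vertex-transitivity of the expected hcp limit says, read energetically).
[difficulty: L] (why it might fail: false iff no local limit of LJ ground states is
energy-transitive at level 2E*: e.g. the true minimiser is a NON-vertex-transitive polytype
(dhcp/4H-type: two site classes straddling the mean), E* is not attained, or every local limit keeps
a positive density of under-bound (foam/defect) sites.) [BlancLewin2015, Radin1991, BaakeGrimm2013,
PartayOrtnerCsanyi2017, Literature.Barriers.AtomisticToContinuum.HcpNotBravais]
#9 FractionalGainGivesTransitivity (support) — K* ⇒ TransitiveLocalLimit (provable now, size M/L):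
on a ground state test K* with c = 1 + t·1_S, S = {i : U_i ≥ 2|E*| + θ}, t = θ/(2(|E*| + C_δ)) (C_δ
bounds pair sums on δ-separated sets, δ = LennardJonesMinimalDistance): |S|/N → 0; the pinned total
Σ_i U_i = −2E(N) = 2|E*|N − o(N) (crysEnergyLimit + K* at c ≡ 1) kills sub-bound sites; particles
whose whole R-ball is θ-transitive have density → 1; diagonal choice of centres,
LocalMatchingCompactness (exists_subseq_forall_eventually_ballMatch) and continuity of site sums
under separated local convergence (r⁻⁶ tail) give X with U ≡ 2|E*|. [difficulty: provable-now]
[BlancLewin2015, BaakeGrimm2013, Xue1997]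
#9 BarlowTransitivityLemma (support) — TRANSITIVITY SELECTS hcp AMONG BARLOW STACKINGS (card K3/P5,
word lemma; provable now from barlowSiteEnergy_eq): at spacings (a, h) where the LJ registry
couplings J_k = barlowCoupling satisfy J₂ < 0 and Σ_(k≥3) |J_k| < |J₂|/2 (numerically |J₂| =
7.3·10⁻⁵ ≫ Σ_(k≥3)|J_k| ≈ 8.5·10⁻⁸; certified form = LjRegistryDomination of route
PoissonBesselStacking), a Hägg word every site of which is bound at least as well as an hcp site is
alternating (layers m, m+2 aligned for all m, i.e. s(m+1) = −s(m)): a site not aligned with layer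
m+2 loses ≥ |J₂|/2 and regains at most Σ_(k≥3)|J_k|. [difficulty: provable-now] [LoachAckland2017,
PartayOrtnerCsanyi2017, ConwaySloane1999,
Literature.Barriers.AtomisticToContinuum.ShortRangeStackingBlindness]

TWO-LAYER PLAN. Foreseen glued splits (not filed now; k ≤ 3, depth 1). UniformBindingRigidity ⇐
UniformBindingCohesion (a uniformly 2E*-bound uniformly
discrete X is r₀-relatively dense: half-space / void-surface sites cannot reach 2|E*| — hemisphere
kissing + second shell) →
UniformBindingIsBarlow (a relatively dense uniformly 2E*-bound X is an isometric image of
barlowStacking a h s with (a,h) in the box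
[47/50,1]×[0.78a,0.85a] — the frustration step, minimax form; extremal-site argument in the hull of
X) → UniformBindingRigidity (via
BarlowTransitivityLemma + certified registry domination stmt-3063 + hcp least among Barlow/periodic,
shared HcpPeriodicMinimiser stmt-3061).
NoFractionalGain ⇐ BarlowNoFractionalGain (K* on the whole Barlow class by Bloch reduction + maximal
row sum, card P5; provable modulo
certified sums) → SeparatedSpectralForm (λ_max[−V_ij] ≤ 2|E*| on 2^(−1/6)-separated sets via
Collatz–Wielandt multiplicative weights /
block-Gershgorin over environments) → NoFractionalGain (copositive reduction of short pairs).

KILL CRITERIA. A finite configuration x with weights c ≥ 0 violating K* (certified: interval lattice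
sums) refutes NoFractionalGain — close
`refuted:NoFractionalGain` unless the violation needs pairs closer than LJ ground states allow, in
which case restate K* on δ-separated
configurations (new item, δ = the proved minimal distance) and re-certify the glue. A uniformly
discrete non-periodic (or non-minimising)
X with all site energies ≤ 2E* refutes UniformBindingRigidity and with it the transitivity endgame —
close `refuted:UniformBindingRigidity`
(the witness is itself news: a uniformly super-bound frustrated structure). TransitiveLocalLimit
refuted (e.g. certified evidence that the
LJ periodic minimiser is a non-transitive polytype) kills the whole line and also
HcpPeriodicMinimiser-based routes. Mooted if a sibling
route proves PeriodicWindows (3240) and CrysPeriodicMinAttained (0627) first.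

NOT DECOMPOSED YET. Deliberately not filed at open (D-0019): the cohesion / Barlow-reduction /
selection children of M* (Two-layer plan); the spectral
(separated) form of K* and its Barlow-class case; the certified registry domination on the box
(consumed from PoissonBesselStacking's
LjRegistryDomination stmt-3063 when BarlowTransitivityLemma is instantiated, not re-filed); the
L²-homogeneity corollary of K* for finite
ground states (Var of site energies ≤ 4|E*|(E(N)/N − E*) → 0, a checkable intermediate); the
sticky/annulus rung of K* (λ_max ≤ max degree
≤ 12 = kissing number) as a litmus. No definition is needed: site sums, local matching and Barlow
site energies are inlined over
existing declarations (energyPerParticle-style subtype tsum; the IsLocalLimitOfGroundStates clause;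
barlowSiteEnergy / barlowCoupling).

CHEAPEST FALSIFIER. The k = 0 Bloch symbol test of K*: for periodic candidates X compute λ_max of
the motif matrix M_st = Σ_(y ∈ sublattice t) [−V_LJ](|x_s − y|)
at the optimal scale and compare with 2|e_hcp*| = 1.4351799 (a* = 0.97123). RUN by this seat (folder
compute/kstar_check.py, pure python,
2 s): hcp 1 (exact), fcc 0.999899, dhcp 0.999949, 9R 0.999965, 6H 0.999932 — all < 1, reproducing
the card's kit j002036 (which adds bcc
0.9566, A15 0.9559 / best site 0.969, C15 0.946, σ 0.933 / best site 0.986, Mackay icosahedra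
spectrally below hcp balls). Noted: dhcp's
B-sites are bound EXACTLY at the hcp level (same alignment pattern) — harmless for K* (Perron root <
max row sum) and for M* (A-sites lose
|J₂|), but it fixes the margin of any certified version at |J₂| ≈ 7·10⁻⁵. Next cheapest: the global
periodic-cell search (card j002476,
critic j007687; outcome not visible to this seat at open).

NUMBERS. BL units V = r⁻¹²/12 − r⁻⁶/6: 2|e_hcp| = 1.4351799 at a* = 0.97123, ideal c/a; e_hcp −
e_fcc ≈ −7.3·10⁻⁵ per particle; λ_max/λ_hcp:
fcc 0.999899, dhcp 0.999949, 9R 0.999965, 6H 0.999932 (this seat), bcc 0.9566, A15 0.9559, C15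
0.946, σ 0.933, sh 0.787, sc 0.661 (card
j002036); registry couplings J₂ = −7.26·10⁻⁵, J₃ = −8.5·10⁻⁸, J₄ ≈ −1·10⁻¹⁰ (card
poisson-bessel-stacking-selection, uncertified), so
Σ_(k≥3)|J_k| / |J₂| ≈ 1.2·10⁻³ ≪ 1/2; LJ ground-state minimal distance: proved qualitatively
(LennardJonesMinimalDistance_holds), all pairs
attractive beyond 2^(−1/6) = 0.8909. Items at open: 6 (3 cruxes, 2 supports, 1 assembly).

DEFINITION REQUESTS. None. (Optional later: `copositiveValue` μ(X) of a distance-kernel matrix and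
the binding function U_X of a locally finite set, topic
Summits/AtomisticToContinuum/Crystallization/Theorems, once a prover wants the spectral form.)

Novelty: Searches (2026-08-16, this seat; local searchd DOWN (connection reset), OpenAlex/S2 HTTP 429): `lit
search --source crossref|zbmath|arxiv`
for "spectral radius distance matrix Lennard-Jones ground state" (crossref 8: graph distance-matrix
spectra, unrelated; zbmath/arxiv 0),
"generalized Hilbert inequality several dimensions well-spaced points kernel operator norm"
(crossref 4: Hilbert-type integral inequalities,
unrelated; 0/0), "copositive optimization kissing number sphere packing bound" (crossref 6: Zong's
chapters, Hales Fields 2013 — density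
bounds, no energy/weights), "radial basis function interpolation matrix eigenvalue bounds separated
points" (crossref 5: Schaback 1994 etc. —
Gershgorin/conditioning bounds, no sharp lattice-extremal λ_max), "Motzkin Straus theorem continuous
analogue Euclidean point configurations
energy" (crossref 6: hypergraph/edge-weighted Motzkin–Straus, no geometry); `lit galaxy search
"spectral radius of the interaction matrix"
--star all` (1 row, neuroscience); `lit galaxy search --star pdf --mode bm25 "standard quadratic
optimization over the simplex Lennard-Jones"`
(12 rows: optimisation tutorials, GP potential fitting, self-assembly design — none on bounds); grep
of the 34 open Theses for "c i * c j /
w i * w j" (6 files, all Bochner positive-type clauses Σ w_i w_j f ≥ 0 of certificate routes —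
weights on a TEST function, not on occupation)
and of Theses/Ideas for Perron|copositive|fractional (only the source card and phantom-pair's menti  [refs: 10.1112/jlms/s2-8.1.73, 10.4153/CJM-1965-053-6, 1206.2608, doi:10.1112/jlms/s2-8.1.73, doi:10.4153/CJM-1965-053-6, MontgomeryVaughan1974, Li2022]

Barriers (technique_class: copositive-spectral-bound, perron-transitivity): - technique_class: copositive-spectral-bound, perron-transitivity
- Literature.Barriers.AtomisticToContinuum.Li2022_cohnElkies3D: two-point LP tightness would imply
K* (Bochner is weight-blind) but not conversely; the line bets on the strict gap between them — K*
is provable by non-Fourier means (Collatz–Wielandt multiplicative weights, block-Gershgorin over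
environments, walk hierarchy, extremal-vector identities) and is refutable by one matrix; no magic
function is sought.
- Literature.Barriers.AtomisticToContinuum.KissingTwelveDegeneracy: evaded — no stacking is selected
by contact counting; transitivity of SITE energies picks ABAB among all Hägg words
(BarlowTransitivityLemma), using exactly the first stacking-sensitive shell √(8/3).
- Literature.Barriers.AtomisticToContinuum.ShortRangeStackingBlindness: respected and used — the
word lemma needs J₂ ≠ 0, i.e. range ≥ √(8/3)·a; for a potential cut below it h- and c-sites are
iso-energetic and the lemma is false, as the barrier says.
- Literature.Barriers.AtomisticToContinuum.TetrahedralFrustration: K* is a global weighted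
statement, not a cell/one-centre inequality (it is false at level n = 1 of its own walk hierarchy);
M* concedes the barrier's content and asks for it in MINIMAX form (uniform, exact, every site) — it
does not evade it; the bet is that uniform super-binding is globally unrealisable although locally
possible.
- Literature.Barriers.AtomisticToContinuum.IcosahedralClusters: finite icosahedral clusters have low

History (route lifecycle, newest last):
- 2026-08-25T11:43:59Z · DORMANT — reconciler: no traction for 7.7 d (last activity item-evidence-added at 2026-08-17T19:13:51Z); parked, not closed — `ledger route dormant route-AtomisticToConti (operator:999:1018077)

sub-problem: Crystallization · status: dormant · opened planner-plan-novel-AtomisticToContinuum-Crystal-ad211d65-g2-0 2026-08-16T14:38:12Z · rev 2 · ledger route-AtomisticToContinuum-PerronTransitivity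
GENERATED by the gate from the ledger (D-0016/17). Provers cite these decls: `theorem foo : Summit.AtomisticToContinuum.Crystallization.Theses.PerronTransitivity.<Decl> := …` in Summits/AtomisticToContinuum/Crystallization/Theorems/<Name>.lean.
-/

namespace Summit.AtomisticToContinuum.Crystallization.Theses.PerronTransitivity

open scoped BigOperators Topology Manifold Classical MeasureTheory ProbabilityTheory Matrix InnerProductSpace ComplexConjugate ContinuousMap
open Filter Set Function TopologicalSpace MeasureTheory

attribute [summit_statement] _root_.Crystallization

/-- item stmt-AtomisticToContinuum-15098 · crux · rank 2 · open · by planner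
why it might fail: one periodic structure whose k=0 Bloch symbol of [−V_ij] has λ_max > 2|E*|: margins 1.0·10⁻⁴ (fcc), 5·10⁻⁵ (dhcp), 3.5·10⁻⁵ (9R) in Barlow, 1.4 % at the best Frank–Kasper site; a Z14/Z16-rich phase concentrating Perron weight on super-bound sites kills it; potential-specific.
sources: MontgomeryVaughan1974, doi:10.4153/CJM-1965-053-6, BlancLewin2015, Li2022, Literature.Barriers.AtomisticToContinuum.IcosahedralClusters
[crux] K* (card K1, copositive form, no separation hypothesis): for every N, every injective x : Fin
N → ℝ³ and every c : Fin N → ℝ with c ≥ 0, 2·E*·Σ_i c_i² ≤ Σ_i Σ_(j≠i) c_i c_j V_LJ(dist x_i x_j),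
E* = ⨅_Q e_LJ(Q). At c ≡ 1 this is the finite Kepler-type floor E(x) ≥ N·E*; sharp (c ≡ 1 on large
hcp blocks). [difficulty: XL] -/
@[route_item "route-AtomisticToContinuum-PerronTransitivity", crux]
def NoFractionalGain : Prop :=
  ∀ (N : ℕ) (x : Fin N → EuclideanSpace ℝ (Fin 3)), Function.Injective x → ∀ c : Fin N → ℝ, (∀ i, 0 ≤ c i) → 2 * (⨅ Q : Literature.MathematicalPhysics.StatisticalMechanics.PeriodicConfiguration 3, Q.energyPerParticle Literature.MathematicalPhysics.StatisticalMechanics.lennardJones) * ∑ i, c i ^ 2 ≤ ∑ i, ∑ j ∈ Finset.univ.erase i, c i * c j * Literature.MathematicalPhysics.StatisticalMechanics.lennardJones (dist (x i) (x j))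

/-- item stmt-AtomisticToContinuum-15099 · crux · rank 3 · open · by planner
why it might fail: uniform super-binding may be realisable by frustrated order: single sites reach 0.986 (σ) / 0.969 (A15) of the hcp level, a compressed icosahedral centre exceeds it; M* bets NO configuration has ALL sites ≥ 2|E*| but periodic minimisers — zero slack, no 3-D extremal-site precedent.
sources: Hales2012, FlatleyTheil2015, LoachAckland2017, Literature.Barriers.AtomisticToContinuum.TetrahedralFrustration, Literature.Barriers.AtomisticToContinuum.IcosahedralClusters, Literature.Barriers.AtomisticToContinuum.KissingTwelveDegeneracy
[crux] M* (card K2, minimax rigidity, lattice-agnostic conclusion): a non-empty uniformly discrete X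
⊆ ℝ³ with Σ'_(q ∈ X, q ≠ p) V_LJ(dist p q) ≤ 2E* at EVERY p ∈ X equals P.points for a periodic
configuration P with IsLeast (range e_LJ) (e_LJ P). Expected witness: relaxed hcp
(vertex-transitive, hcpStacking_homogeneous); inside the Barlow class it is the word lemma
BarlowTransitivityLemma; voids, surfaces, faults and strain gradients all under-bind some site, so
the uniform hypothesis excludes them for free. [difficulty: XL] -/
@[route_item "route-AtomisticToContinuum-PerronTransitivity", crux]
def UniformBindingRigidity : Prop :=
  ∀ X : Set (EuclideanSpace ℝ (Fin 3)), X.Nonempty → (∃ δ : ℝ, 0 < δ ∧ ∀ p ∈ X, ∀ q ∈ X, p ≠ q → δ ≤ dist p q) → (∀ p ∈ X, ∑' q : {q : EuclideanSpace ℝ (Fin 3) // q ∈ X ∧ q ≠ p}, Literature.MathematicalPhysics.StatisticalMechanics.lennardJones (dist p q.1) ≤ 2 * ⨅ Q : Literature.MathematicalPhysics.StatisticalMechanics.PeriodicConfiguration 3, Q.energyPerParticle Literature.MathematicalPhysics.StatisticalMechanics.lennardJones) → ∃ P : Literature.MathematicalPhysics.StatisticalMechanics.PeriodicConfiguration 3,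 P.points = X ∧ IsLeast (Set.range fun Q : Literature.MathematicalPhysics.StatisticalMechanics.PeriodicConfiguration 3 => Q.energyPerParticle Literature.MathematicalPhysics.StatisticalMechanics.lennardJones) (P.energyPerParticle Literature.MathematicalPhysics.StatisticalMechanics.lennardJones)

/-- item stmt-AtomisticToContinuum-15100 · crux · rank 4 · open · by planner
why it might fail: false iff no local limit of LJ ground states is energy-transitive at level 2E*: e.g. the true minimiser is a NON-vertex-transitive polytype (dhcp/4H-type: two site classes straddling the mean), E* is not attained, or every local limit keeps a positive density of under-bound (foam/defect) sites.
sources: BlancLewin2015, Radin1991, BaakeGrimm2013, PartayOrtnerCsanyi2017, Literature.Barriers.AtomisticToContinuum.HcpNotBravais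
[crux] EXACTLY ENERGY-TRANSITIVE LOCAL LIMIT (card P1+P2 made one statement): every sequence of
Lennard-Jones ground states x^N in ℝ³ has, along a subsequence σ and after translations τ_j, a
non-empty uniformly discrete local limit X (two-way ε-matching on every ball ‖·‖ ≤ R, eventually in
j — the clause of IsLocalLimitOfGroundStates) every site of which has site energy EXACTLY 2E*.
Derived from K* by the support FractionalGainGivesTransitivity; attackable directly (it is what
vertex-transitivity of the expected hcp limit says, read energetically). [difficulty: L] -/
@[route_item "route-AtomisticToContinuum-PerronTransitivity", crux]
def TransitiveLocalLimit : Prop :=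
  ∀ x : (N : ℕ) → (Fin N → EuclideanSpace ℝ (Fin 3)), (∀ N, Literature.MathematicalPhysics.StatisticalMechanics.IsGroundState Literature.MathematicalPhysics.StatisticalMechanics.lennardJones (x N)) → ∃ (X : Set (EuclideanSpace ℝ (Fin 3))) (σ : ℕ → ℕ) (τ : ℕ → EuclideanSpace ℝ (Fin 3)), X.Nonempty ∧ (∃ δ : ℝ, 0 < δ ∧ ∀ p ∈ X, ∀ q ∈ X, p ≠ q → δ ≤ dist p q) ∧ StrictMono σ ∧ (∀ R ε : ℝ, 0 < ε → ∀ᶠ j : ℕ in Filter.atTop, (∀ p ∈ X, ‖p‖ ≤ R → ∃ i : Fin (σ j), dist (x (σ j) i + τ j) p ≤ ε) ∧ (∀ i : Fin (σ j), ‖x (σ j) i + τ j‖ ≤ R → ∃ p ∈ X, dist (x (σ j) i + τ j) p ≤ ε)) ∧ ∀ p ∈ X, ∑' q : {q : EuclideanSpace ℝ (Fin 3) // q ∈ X ∧ q ≠ p}, Literature.MathematicalPhysics.StatisticalMechanics.lennardJones (dist p q.1) = 2 * ⨅ Q : Literature.MathematicalPhysics.StatisticalMechanics.PeriodicConfiguration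 3, Q.energyPerParticle Literature.MathematicalPhysics.StatisticalMechanics.lennardJones

/-- item stmt-AtomisticToContinuum-15101 · support · rank 9 · closed · proved by Summit.AtomisticToContinuum.Crystallization.Theorems.TransitiveLocalLimitBirth.fractionalGainGivesTransitivity_proof @ 64fc2e2fbc71 (prover) · by planner
sources: BlancLewin2015, BaakeGrimm2013, Xue1997
[support] K* ⇒ TransitiveLocalLimit (provable now, size M/L): on a ground state test K* with c = 1 +
t·1_S, S = {i : U_i ≥ 2|E*| + θ}, t = θ/(2(|E*| + C_δ)) (C_δ bounds pair sums on δ-separated sets, δ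
= LennardJonesMinimalDistance): |S|/N → 0; the pinned total Σ_i U_i = −2E(N) = 2|E*|N − o(N)
(crysEnergyLimit + K* at c ≡ 1) kills sub-bound sites; particles whose whole R-ball is θ-transitive
have density → 1; diagonal choice of centres, LocalMatchingCompactness
(exists_subseq_forall_eventually_ballMatch) and continuity of site sums under separated local
convergence (r⁻⁶ tail) give X with U ≡ 2|E*|. [difficulty: provable-now] -/
@[route_item "route-AtomisticToContinuum-PerronTransitivity"]
def FractionalGainGivesTransitivity : Prop :=
  NoFractionalGain → TransitiveLocalLimit

/-- item stmt-AtomisticToContinuum-15102 · support · rank 9 · open · by planner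
sources: LoachAckland2017, PartayOrtnerCsanyi2017, ConwaySloane1999, Literature.Barriers.AtomisticToContinuum.ShortRangeStackingBlindness
[support] TRANSITIVITY SELECTS hcp AMONG BARLOW STACKINGS (card K3/P5, word lemma; provable now from
barlowSiteEnergy_eq): at spacings (a, h) where the LJ registry couplings J_k = barlowCoupling
satisfy J₂ < 0 and Σ_(k≥3) |J_k| < |J₂|/2 (numerically |J₂| = 7.3·10⁻⁵ ≫ Σ_(k≥3)|J_k| ≈ 8.5·10⁻⁸;
certified form = LjRegistryDomination of route PoissonBesselStacking), a Hägg word every site of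
which is bound at least as well as an hcp site is alternating (layers m, m+2 aligned for all m, i.e.
s(m+1) = −s(m)): a site not aligned with layer m+2 loses ≥ |J₂|/2 and regains at most Σ_(k≥3)|J_k|.
[difficulty: provable-now] -/
@[route_item "route-AtomisticToContinuum-PerronTransitivity"]
def BarlowTransitivityLemma : Prop :=
  ∀ a h : ℝ, 0 < a → 0 < h → (Summable fun k : ℕ => Literature.MathematicalPhysics.StatisticalMechanics.layerInteraction Literature.MathematicalPhysics.StatisticalMechanics.lennardJones a h 0 k) → (Summable fun k : ℕ => Literature.MathematicalPhysics.StatisticalMechanics.layerInteraction Literature.MathematicalPhysics.StatisticalMechanics.lennardJones a h 1 k) → Literature.MathematicalPhysics.StatisticalMechanics.barlowCoupling Literature.MathematicalPhysics.StatisticalMechanics.lennardJones a h 2 < 0 → (∑' k : ℕ, |Literature.MathematicalPhysics.StatisticalMechanics.barlowCoupling Literature.MathematicalPhysics.StatisticalMechanics.lennardJones a h (k + 3)|) < -(Literature.MathematicalPhysics.StatisticalMechanics.barlowCoupling Literature.MathematicalPhysics.StatisticalMechanics.lennardJones a h 2) / 2 → ∀ s : ℤ → ℤ, Literature.MathematicalPhysics.StatisticalMechanics.IsHaggSeq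 s → (∀ m : ℤ, Literature.MathematicalPhysics.StatisticalMechanics.barlowSiteEnergy Literature.MathematicalPhysics.StatisticalMechanics.lennardJones a h s m ≤ Literature.MathematicalPhysics.StatisticalMechanics.barlowSiteEnergy Literature.MathematicalPhysics.StatisticalMechanics.lennardJones a h Literature.MathematicalPhysics.StatisticalMechanics.alternatingHagg 0) → ∀ m : ℤ, s (m + 1) = -s m

/-- item stmt-AtomisticToContinuum-15103 · assembly · rank 1 · open · by planner
sources: BlancLewin2015
[assembly] NoFractionalGain → FractionalGainGivesTransitivity → UniformBindingRigidity →
Crystallization (both conjuncts). -/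
@[route_item "route-AtomisticToContinuum-PerronTransitivity"]
def Assembly : Prop :=
  NoFractionalGain → FractionalGainGivesTransitivity → UniformBindingRigidity → _root_.Crystallization

/-! D-0027 §2.1 — DECIDING THEOREM (planner-authored via `route open/edit --closes-file`; by planner-plan-novel-AtomisticToContinuum-Crystal-ad211d65-g2- 2026-08-16T14:40:16Z):
its hypotheses are this route's items and its conclusion the sub-problem Statement (glue_lint), and it elaborates with this file. -/

@[closes "route-AtomisticToContinuum-PerronTransitivity"] theorem closes : NoFractionalGain → UniformBindingRigidity → TransitiveLocalLimit →
    _root_.Crystallization := by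
  -- CRUX-ONLY deciding theorem: K* (hypothesis 1) feeds TransitiveLocalLimit (hypothesis 3) through the
  -- support item FractionalGainGivesTransitivity (K* → TransitiveLocalLimit, provable now); the proof term
  -- below needs only the transitive local limit and its rigidity M* (hypothesis 2).
  intro _hK hM hT
  have key : ∀ x : (N : ℕ) → (Fin N → EuclideanSpace ℝ (Fin 3)),
      (∀ N, Literature.MathematicalPhysics.StatisticalMechanics.IsGroundState
        Literature.MathematicalPhysics.StatisticalMechanics.lennardJones (x N)) →
      ∃ (P : Literature.MathematicalPhysics.StatisticalMechanics.PeriodicConfiguration 3)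
        (σ : ℕ → ℕ) (τ : ℕ → EuclideanSpace ℝ (Fin 3)), StrictMono σ ∧
        (∀ R ε : ℝ, 0 < ε → ∀ᶠ j : ℕ in Filter.atTop,
          (∀ p ∈ P.points, ‖p‖ ≤ R → ∃ i : Fin (σ j), dist (x (σ j) i + τ j) p ≤ ε) ∧
          (∀ i : Fin (σ j), ‖x (σ j) i + τ j‖ ≤ R → ∃ p ∈ P.points, dist (x (σ j) i + τ j) p ≤ ε)) ∧
        IsLeast (Set.range fun Q : Literature.MathematicalPhysics.StatisticalMechanics.PeriodicConfiguration 3 =>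
          Q.energyPerParticle Literature.MathematicalPhysics.StatisticalMechanics.lennardJones)
          (P.energyPerParticle Literature.MathematicalPhysics.StatisticalMechanics.lennardJones) := by
    intro x hx
    obtain ⟨X, σ, τ, hne, hsep, hσ, hlim, hU⟩ := hT x hx
    obtain ⟨P, hPX, hleast⟩ := hM X hne hsep (fun p hp => (hU p hp).le)
    subst hPX
    exact ⟨P, σ, τ, hσ, hlim, hleast⟩
  refine ⟨?_, ?_⟩
  · -- conjunct (i): ground states exist, their transitive limit is a least periodic configuration,
    -- and E(N)/N → ⨅ = e(P) (crysEnergyLimit, proved in tree)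
    choose x hx using
      Literature.MathematicalPhysics.StatisticalMechanics.LennardJonesGroundStatesExist_holds
    obtain ⟨P, σ, τ, -, -, hleast⟩ := key x hx
    have h : (⨅ Q : Literature.MathematicalPhysics.StatisticalMechanics.PeriodicConfiguration 3,
        Q.energyPerParticle Literature.MathematicalPhysics.StatisticalMechanics.lennardJones) =
        P.energyPerParticle Literature.MathematicalPhysics.StatisticalMechanics.lennardJones :=
      hleast.csInf_eq
    have hlimE := _root_.Summit.AtomisticToContinuum.Crystallization.Theorems.ChargedEnergyGapNegative.crysEnergyLimit
    rw [h] at hlimE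
    exact ⟨P, hleast, hlimE⟩
  · -- conjunct (ii): the periodic local limit IS Blanc–Lewin local convergence (multiplicity one), by the
    -- proved criterion `PeriodicConfiguration.tendsto_sum_of_eventually_near'` and the proved minimal distance
    intro x hx
    obtain ⟨P, σ, τ, hσ, hlim, -⟩ := key x hx
    obtain ⟨δ, hδ, hδsep⟩ :=
      Literature.MathematicalPhysics.StatisticalMechanics.LennardJonesMinimalDistance_holds
    refine ⟨σ, τ, P, fun _ => 1, hσ, fun s _ => le_rfl, fun g _ s => rfl, ?_⟩
    intro f hfc hf
    have hsep : ∀ (j : ℕ) (i i' : Fin (σ j)), i ≠ i' →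
        δ ≤ dist (x (σ j) i + τ j) (x (σ j) i' + τ j) := by
      intro j i i' hii'
      rw [dist_add_right]
      exact hδsep (σ j) (x (σ j)) (hx (σ j)) i i' hii'
    simpa using P.tendsto_sum_of_eventually_near' (fun j i => x (σ j) i + τ j) hδ hsep hlim hfc hf

end Summit.AtomisticToContinuum.Crystallization.Theses.PerronTransitivity
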